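import Summits.AtomisticToContinuum.Crystallization.Theorems.PalmUnimodularRigidityShellsToBarlowChartTransportSteps1
import Summits.AtomisticToContinuum.Crystallization.Theorems.PalmUnimodularRigidityShellsToBarlowChartTransportSteps2
import Summits.AtomisticToContinuum.Crystallization.Theorems.PalmUnimodularRigidityShellsToBarlowChartTransportSteps3
import Summits.AtomisticToContinuum.Crystallization.Theorems.PalmUnimodularRigidityShellsToBarlowChartTransportSteps5
import Summits.AtomisticToContinuum.Crystallization.Theorems.PalmUnimodularRigidityShellsToBarlowChartTransportSteps7
import Summits.AtomisticToContinuum.Crystallization.Theorems.PalmUnimodularRigidityShellsToBarlowChartTransportVinv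
import Summits.AtomisticToContinuum.Crystallization.Theorems.PalmUnimodularRigidityShellsToBarlowChartTransportComm1
import Summits.AtomisticToContinuum.Crystallization.Theorems.PalmUnimodularRigidityShellsToBarlowChartTransportComm3
import Summits.AtomisticToContinuum.Crystallization.Theorems.PalmUnimodularRigidityShellsToBarlowChartTransportVComm3

/-!
# Line `develop-the-model-growth-descent` (crux `ShellsToBarlowChart`, stmt-AtomisticToContinuum-9227): coherent layers and their `V` / `V⁻¹` images

Helper lemmas for `stub_transportSystem` (the geometric half of the line): frames `⟨x, t₁, t₂, U⟩`
read in the integer charts `IsZChart` of a good-shell configuration, their transports and the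
coherence of the resulting development `frameAt`.  The only metric inputs are the chart transfer
lemma and `bond_nb_iff`; everything else is label combinatorics in `ℤ³` (pattern facts
`TransportPatterns*`).  All `[folklore]` (HalesDSP2012 §1.3 for the two kissing patterns).
-/

noncomputable section

namespace Summit.AtomisticToContinuum.Crystallization.Theorems.PalmUnimodularRigidityShellsToBarlowChart

open Literature.Geometry.DiscreteGeometry Literature.MathematicalPhysics.StatisticalMechanics
open Summit.AtomisticToContinuum.Crystallization.Theorems.ShellsToBarlowChartNegative

variable {S : Set (EuclideanSpace ℝ (Fin 3))} {ac : (EuclideanSpace ℝ (Fin 3)) → ℝ} {Pc : (EuclideanSpace ℝ (Fin 3)) → Finset (Fin 3 → ℤ)}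
  {Ac : (EuclideanSpace ℝ (Fin 3)) → ((EuclideanSpace ℝ (Fin 3)) →ₗᵢ[ℝ] (EuclideanSpace ℝ (Fin 3)))} {nb : (EuclideanSpace ℝ (Fin 3)) → (Fin 3 → ℤ) → (EuclideanSpace ℝ (Fin 3))}

/-- Going back along `I`: if `⟨x, t₁, t₂, U⟩ = I g'` for a valid `g' = ⟨x', a, b, W⟩` then
`I⁻¹ ⟨x, t₁, t₂, U⟩ = g'`, `nb x (−t₁) = x'`, and the I-regime holds at `g'`. [folklore] -/
theorem back_I (hch : ∀ z ∈ S, IsZChart S z (ac z) (Pc z) (Ac z) (nb z)) {x x' : (EuclideanSpace ℝ (Fin 3))} {t₁ t₂ a b : Fin 3 → ℤ} {U W : Finset (Fin 3 → ℤ)} (hx' : x' ∈ S) (hW : IsFrame (Pc x') a b W) (hU : IsFrame (Pc x) t₁ t₂ U) (hrel : (⟨x, t₁, t₂, U⟩ : ZFrame) = Istep Pc nb ⟨x', a, b, W⟩) : IinvStep Pc nb ⟨x, t₁, t₂, U⟩ = ⟨x', a, b, W⟩ ∧ nb x (-t₁) = x' ∧ IsFrame (Pc (nb x' a)) (Istep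 Pc nb ⟨x', a, b, W⟩).t₁ (Istep Pc nb ⟨x', a, b, W⟩).t₂ (Istep Pc nb ⟨x', a, b, W⟩).U := by
  have hxe : x = (Istep Pc nb ⟨x', a, b, W⟩).pt := congrArg ZFrame.pt hrel
  have ht₁e : t₁ = (Istep Pc nb ⟨x', a, b, W⟩).t₁ := congrArg ZFrame.t₁ hrel
  have ht₂e : t₂ = (Istep Pc nb ⟨x', a, b, W⟩).t₂ := congrArg ZFrame.t₂ hrel
  have hUe : U = (Istep Pc nb ⟨x', a, b, W⟩).U := congrArg ZFrame.U hrel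
  have hval : IsFrame (Pc (nb x' a)) (Istep Pc nb ⟨x', a, b, W⟩).t₁ (Istep Pc nb ⟨x', a, b, W⟩).t₂
      (Istep Pc nb ⟨x', a, b, W⟩).U := by
    rw [hxe, ht₁e, ht₂e, hUe] at hU; exact hU
  have hreg := hregI_of_valid (Pc := Pc) (nb := nb) hval
  obtain ⟨-, -, -, hwx, -⟩ := Istep_spec hch hx' hW hreg
  have hback : nb x (-t₁) = x' := by
    rw [hxe, ht₁e]
    show nb (nb x' a) (-(-zlab Pc nb (nb x' a) x')) = x'
    rw [neg_neg]; exact hwx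
  refine ⟨?_, hback, hval⟩
  rw [hrel]; exact IinvStep_Istep hch hx' hW hreg

/-- Going back along `J` (symmetric to `back_I`). [folklore] -/
theorem back_J (hch : ∀ z ∈ S, IsZChart S z (ac z) (Pc z) (Ac z) (nb z)) {x x' : (EuclideanSpace ℝ (Fin 3))}
    {t₁ t₂ a b : Fin 3 → ℤ} {U W : Finset (Fin 3 → ℤ)} (hx' : x' ∈ S) (hW : IsFrame (Pc x') a b W)
    (hU : IsFrame (Pc x) t₁ t₂ U) (hrel : (⟨x, t₁, t₂, U⟩ : ZFrame) = Jstep Pc nb ⟨x', a, b, W⟩) :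
    JinvStep Pc nb ⟨x, t₁, t₂, U⟩ = ⟨x', a, b, W⟩ ∧ nb x (-t₂) = x' ∧
      IsFrame (Pc (nb x' b)) (Jstep Pc nb ⟨x', a, b, W⟩).t₁ (Jstep Pc nb ⟨x', a, b, W⟩).t₂
        (Jstep Pc nb ⟨x', a, b, W⟩).U := by
  have hxe : x = (Jstep Pc nb ⟨x', a, b, W⟩).pt := congrArg ZFrame.pt hrel
  have ht₁e : t₁ = (Jstep Pc nb ⟨x', a, b, W⟩).t₁ := congrArg ZFrame.t₁ hrel
  have ht₂e : t₂ = (Jstep Pc nb ⟨x', a, b, W⟩).t₂ := congrArg ZFrame.t₂ hrel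
  have hUe : U = (Jstep Pc nb ⟨x', a, b, W⟩).U := congrArg ZFrame.U hrel
  have hval : IsFrame (Pc (nb x' b)) (Jstep Pc nb ⟨x', a, b, W⟩).t₁ (Jstep Pc nb ⟨x', a, b, W⟩).t₂
      (Jstep Pc nb ⟨x', a, b, W⟩).U := by
    rw [hxe, ht₁e, ht₂e, hUe] at hU; exact hU
  have hreg := hregJ_of_valid (Pc := Pc) (nb := nb) hval
  obtain ⟨-, -, -, hwx, -⟩ := Jstep_spec hch hx' hW hreg
  have hback : nb x (-t₂) = x' := by
    rw [hxe, ht₂e]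
    show nb (nb x' b) (-(-zlab Pc nb (nb x' b) x')) = x'
    rw [neg_neg]; exact hwx
  refine ⟨?_, hback, hval⟩
  rw [hrel]; exact JinvStep_Jstep hch hx' hW hreg

/-- **The neighbourhood of a site of a coherent layer.**  In a family `Φ : ℤ² → frames` that is
valid everywhere and coherent (`Φ (i+1) j = I (Φ i j)`, `Φ i (j+1) = J (Φ i j)`), every frame
`⟨x, t₁, t₂, U⟩ = Φ i j` has all the hypotheses of the commutation theorems: the eight frames
around it are valid and the in-layer commutation holds. [folklore] -/
theorem nbhd (hch : ∀ z ∈ S, IsZChart S z (ac z) (Pc z) (Ac z) (nb z)) {Φ : ℤ → ℤ → ZFrame}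
    (hval : ∀ i j, IsFrame (Pc (Φ i j).pt) (Φ i j).t₁ (Φ i j).t₂ (Φ i j).U)
    (hS : ∀ i j, (Φ i j).pt ∈ S) (hI : ∀ i j, Φ (i + 1) j = Istep Pc nb (Φ i j))
    (hJ : ∀ i j, Φ i (j + 1) = Jstep Pc nb (Φ i j)) (i j : ℤ) {x : (EuclideanSpace ℝ (Fin 3))} {t₁ t₂ : Fin 3 → ℤ}
    {U : Finset (Fin 3 → ℤ)} (h : Φ i j = ⟨x, t₁, t₂, U⟩) :
    x ∈ S ∧ IsFrame (Pc x) t₁ t₂ U ∧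
    IsFrame (Pc (nb x t₁)) (Istep Pc nb ⟨x, t₁, t₂, U⟩).t₁ (Istep Pc nb ⟨x, t₁, t₂, U⟩).t₂
      (Istep Pc nb ⟨x, t₁, t₂, U⟩).U ∧
    IsFrame (Pc (nb x t₂)) (Jstep Pc nb ⟨x, t₁, t₂, U⟩).t₁ (Jstep Pc nb ⟨x, t₁, t₂, U⟩).t₂
      (Jstep Pc nb ⟨x, t₁, t₂, U⟩).U ∧
    IsFrame (Pc (nb x (-t₁))) (IinvStep Pc nb ⟨x, t₁, t₂, U⟩).t₁
      (IinvStep Pc nb ⟨x, t₁, t₂, U⟩).t₂ (IinvStep Pc nb ⟨x, t₁, t₂, U⟩).U ∧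
    IsFrame (Pc (nb x (-t₂))) (JinvStep Pc nb ⟨x, t₁, t₂, U⟩).t₁
      (JinvStep Pc nb ⟨x, t₁, t₂, U⟩).t₂ (JinvStep Pc nb ⟨x, t₁, t₂, U⟩).U ∧
    IsFrame (Pc (nb (nb x t₁) (Istep Pc nb ⟨x, t₁, t₂, U⟩).t₁))
      (Istep Pc nb (Istep Pc nb ⟨x, t₁, t₂, U⟩)).t₁ (Istep Pc nb (Istep Pc nb ⟨x, t₁, t₂, U⟩)).t₂
      (Istep Pc nb (Istep Pc nb ⟨x, t₁, t₂, U⟩)).U ∧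
    IsFrame (Pc (nb (nb x t₁) (Istep Pc nb ⟨x, t₁, t₂, U⟩).t₂))
      (Jstep Pc nb (Istep Pc nb ⟨x, t₁, t₂, U⟩)).t₁ (Jstep Pc nb (Istep Pc nb ⟨x, t₁, t₂, U⟩)).t₂
      (Jstep Pc nb (Istep Pc nb ⟨x, t₁, t₂, U⟩)).U ∧
    IsFrame (Pc (nb (nb x t₁) (-(Istep Pc nb ⟨x, t₁, t₂, U⟩).t₁)))
      (IinvStep Pc nb (Istep Pc nb ⟨x, t₁, t₂, U⟩)).t₁ (IinvStep Pc nb (Istep Pc nb ⟨x, t₁, t₂, U⟩)).t₂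
      (IinvStep Pc nb (Istep Pc nb ⟨x, t₁, t₂, U⟩)).U ∧
    IsFrame (Pc (nb (nb x t₁) (-(Istep Pc nb ⟨x, t₁, t₂, U⟩).t₂)))
      (JinvStep Pc nb (Istep Pc nb ⟨x, t₁, t₂, U⟩)).t₁ (JinvStep Pc nb (Istep Pc nb ⟨x, t₁, t₂, U⟩)).t₂
      (JinvStep Pc nb (Istep Pc nb ⟨x, t₁, t₂, U⟩)).U ∧
    IsFrame (Pc (nb (nb x t₂) (Jstep Pc nb ⟨x, t₁, t₂, U⟩).t₂))
      (Jstep Pc nb (Jstep Pc nb ⟨x, t₁, t₂, U⟩)).t₁ (Jstep Pc nb (Jstep Pc nb ⟨x, t₁, t₂, U⟩)).t₂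
      (Jstep Pc nb (Jstep Pc nb ⟨x, t₁, t₂, U⟩)).U ∧
    IsFrame (Pc (nb (nb x t₂) (Jstep Pc nb ⟨x, t₁, t₂, U⟩).t₁))
      (Istep Pc nb (Jstep Pc nb ⟨x, t₁, t₂, U⟩)).t₁ (Istep Pc nb (Jstep Pc nb ⟨x, t₁, t₂, U⟩)).t₂
      (Istep Pc nb (Jstep Pc nb ⟨x, t₁, t₂, U⟩)).U ∧
    IsFrame (Pc (nb (nb x t₂) (-(Jstep Pc nb ⟨x, t₁, t₂, U⟩).t₂)))
      (JinvStep Pc nb (Jstep Pc nb ⟨x, t₁, t₂, U⟩)).t₁ (JinvStep Pc nb (Jstep Pc nb ⟨x, t₁, t₂, U⟩)).t₂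
      (JinvStep Pc nb (Jstep Pc nb ⟨x, t₁, t₂, U⟩)).U ∧
    IsFrame (Pc (nb (nb x t₂) (-(Jstep Pc nb ⟨x, t₁, t₂, U⟩).t₁)))
      (IinvStep Pc nb (Jstep Pc nb ⟨x, t₁, t₂, U⟩)).t₁ (IinvStep Pc nb (Jstep Pc nb ⟨x, t₁, t₂, U⟩)).t₂
      (IinvStep Pc nb (Jstep Pc nb ⟨x, t₁, t₂, U⟩)).U ∧
    Istep Pc nb (Jstep Pc nb ⟨x, t₁, t₂, U⟩) = Jstep Pc nb (Istep Pc nb ⟨x, t₁, t₂, U⟩) := by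
  -- validity of any `Φ i' j'` written as an explicit expression
  have hvalE : ∀ (i' j' : ℤ) (E : ZFrame), Φ i' j' = E → IsFrame (Pc E.pt) E.t₁ E.t₂ E.U := by
    intro i' j' E hE; rw [← hE]; exact hval i' j'
  have hx : x ∈ S := by have := hS i j; rw [h] at this; exact this
  have hU : IsFrame (Pc x) t₁ t₂ U := hvalE i j _ h
  -- forward expressions
  have eI : Φ (i + 1) j = Istep Pc nb ⟨x, t₁, t₂, U⟩ := by rw [hI, h]
  have eJ : Φ i (j + 1) = Jstep Pc nb ⟨x, t₁, t₂, U⟩ := by rw [hJ, h]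
  have eII : Φ (i + 1 + 1) j = Istep Pc nb (Istep Pc nb ⟨x, t₁, t₂, U⟩) := by rw [hI, eI]
  have eJI : Φ (i + 1) (j + 1) = Jstep Pc nb (Istep Pc nb ⟨x, t₁, t₂, U⟩) := by rw [hJ, eI]
  have eJJ : Φ i (j + 1 + 1) = Jstep Pc nb (Jstep Pc nb ⟨x, t₁, t₂, U⟩) := by rw [hJ, eJ]
  have eIJ : Φ (i + 1) (j + 1) = Istep Pc nb (Jstep Pc nb ⟨x, t₁, t₂, U⟩) := by rw [hI, eJ]
  have hcomm : Istep Pc nb (Jstep Pc nb ⟨x, t₁, t₂, U⟩) = Jstep Pc nb (Istep Pc nb ⟨x, t₁, t₂, U⟩) := by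
    rw [← eIJ, ← eJI]
  have hIg := hvalE _ _ _ eI
  have hJg := hvalE _ _ _ eJ
  have hIIg := hvalE _ _ _ eII
  have hJIg := hvalE _ _ _ eJI
  have hJJg := hvalE _ _ _ eJJ
  have hIJg := hvalE _ _ _ eIJ
  -- backward along I at `(i, j)`: `Φ (i−1) j`
  rcases hm : Φ (i - 1) j with ⟨x', a, b, W⟩
  have hx' : x' ∈ S := by have := hS (i - 1) j; rw [hm] at this; exact this
  have hW : IsFrame (Pc x') a b W := hvalE _ _ _ hm
  have hrelI : (⟨x, t₁, t₂, U⟩ : ZFrame) = Istep Pc nb ⟨x', a, b, W⟩ := by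
    rw [← h, ← hm, ← hI, Int.sub_add_cancel]
  obtain ⟨hIinv, hbackI, -⟩ := back_I hch hx' hW hU hrelI
  -- backward along J at `(i, j)`: `Φ i (j−1)`
  rcases hn : Φ i (j - 1) with ⟨x'', a', b', W'⟩
  have hx'' : x'' ∈ S := by have := hS i (j - 1); rw [hn] at this; exact this
  have hW' : IsFrame (Pc x'') a' b' W' := hvalE _ _ _ hn
  have hrelJ : (⟨x, t₁, t₂, U⟩ : ZFrame) = Jstep Pc nb ⟨x'', a', b', W'⟩ := by
    rw [← h, ← hn, ← hJ, Int.sub_add_cancel]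
  obtain ⟨hJinv, hbackJ, -⟩ := back_J hch hx'' hW' hU hrelJ
  have hIig : IsFrame (Pc (nb x (-t₁))) (IinvStep Pc nb ⟨x, t₁, t₂, U⟩).t₁
      (IinvStep Pc nb ⟨x, t₁, t₂, U⟩).t₂ (IinvStep Pc nb ⟨x, t₁, t₂, U⟩).U := by
    rw [hIinv, hbackI]; exact hW
  have hJig : IsFrame (Pc (nb x (-t₂))) (JinvStep Pc nb ⟨x, t₁, t₂, U⟩).t₁
      (JinvStep Pc nb ⟨x, t₁, t₂, U⟩).t₂ (JinvStep Pc nb ⟨x, t₁, t₂, U⟩).U := by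
    rw [hJinv, hbackJ]; exact hW'
  -- `I⁻¹ (I g) = g`, `J⁻¹ (J g) = g`
  have hregI := hregI_of_valid (Pc := Pc) (nb := nb) hIg
  have hregJ := hregJ_of_valid (Pc := Pc) (nb := nb) hJg
  obtain ⟨hyS, -, -, hwx, -⟩ := Istep_spec hch hx hU hregI
  obtain ⟨hyJS, -, -, hwxJ, -⟩ := Jstep_spec hch hx hU hregJ
  have hIiIg : IsFrame (Pc (nb (nb x t₁) (-(Istep Pc nb ⟨x, t₁, t₂, U⟩).t₁)))
      (IinvStep Pc nb (Istep Pc nb ⟨x, t₁, t₂, U⟩)).t₁ (IinvStep Pc nb (Istep Pc nb ⟨x, t₁, t₂, U⟩)).t₂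
      (IinvStep Pc nb (Istep Pc nb ⟨x, t₁, t₂, U⟩)).U := by
    rw [IinvStep_Istep hch hx hU hregI]
    have e : nb (nb x t₁) (-(Istep Pc nb ⟨x, t₁, t₂, U⟩).t₁) = x := by
      show nb (nb x t₁) (-(-zlab Pc nb (nb x t₁) x)) = x
      rw [neg_neg]; exact hwx
    rw [e]; exact hU
  have hJiJg : IsFrame (Pc (nb (nb x t₂) (-(Jstep Pc nb ⟨x, t₁, t₂, U⟩).t₂)))
      (JinvStep Pc nb (Jstep Pc nb ⟨x, t₁, t₂, U⟩)).t₁ (JinvStep Pc nb (Jstep Pc nb ⟨x, t₁, t₂, U⟩)).t₂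
      (JinvStep Pc nb (Jstep Pc nb ⟨x, t₁, t₂, U⟩)).U := by
    rw [JinvStep_Jstep hch hx hU hregJ]
    have e : nb (nb x t₂) (-(Jstep Pc nb ⟨x, t₁, t₂, U⟩).t₂) = x := by
      show nb (nb x t₂) (-(-zlab Pc nb (nb x t₂) x)) = x
      rw [neg_neg]; exact hwxJ
    rw [e]; exact hU
  -- `J⁻¹ (I g) = Φ (i+1) (j−1)` and `I⁻¹ (J g) = Φ (i−1) (j+1)`
  rcases hp : Φ (i + 1) (j - 1) with ⟨xp, ap, bp, Wp⟩
  have hxp : xp ∈ S := by have := hS (i + 1) (j - 1); rw [hp] at this; exact this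
  have hWp : IsFrame (Pc xp) ap bp Wp := hvalE _ _ _ hp
  rcases hq : Istep Pc nb ⟨x, t₁, t₂, U⟩ with ⟨xq, aq, bq, Wq⟩
  have hrelp : (⟨xq, aq, bq, Wq⟩ : ZFrame) = Jstep Pc nb ⟨xp, ap, bp, Wp⟩ := by
    rw [← hq, ← eI, ← hp, ← hJ, Int.sub_add_cancel]
  have hUq : IsFrame (Pc xq) aq bq Wq := by
    have := hIg; rw [hq] at this; exact this
  obtain ⟨hJinvq, hbackq, -⟩ := back_J hch hxp hWp hUq hrelp
  have hJiIg : IsFrame (Pc (nb (nb x t₁) (-(Istep Pc nb ⟨x, t₁, t₂, U⟩).t₂)))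
      (JinvStep Pc nb (Istep Pc nb ⟨x, t₁, t₂, U⟩)).t₁ (JinvStep Pc nb (Istep Pc nb ⟨x, t₁, t₂, U⟩)).t₂
      (JinvStep Pc nb (Istep Pc nb ⟨x, t₁, t₂, U⟩)).U := by
    have ex : nb x t₁ = xq := congrArg ZFrame.pt hq
    rw [hq, ex, hJinvq]
    show IsFrame (Pc (nb xq (-bq))) ap bp Wp
    rw [hbackq]; exact hWp
  rcases hr : Φ (i - 1) (j + 1) with ⟨xr, ar, br, Wr⟩
  have hxr : xr ∈ S := by have := hS (i - 1) (j + 1); rw [hr] at this; exact this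
  have hWr : IsFrame (Pc xr) ar br Wr := hvalE _ _ _ hr
  rcases hs : Jstep Pc nb ⟨x, t₁, t₂, U⟩ with ⟨xs, as, bs, Ws⟩
  have hrels : (⟨xs, as, bs, Ws⟩ : ZFrame) = Istep Pc nb ⟨xr, ar, br, Wr⟩ := by
    rw [← hs, ← eJ, ← hr, ← hI, Int.sub_add_cancel]
  have hUs : IsFrame (Pc xs) as bs Ws := by
    have := hJg; rw [hs] at this; exact this
  obtain ⟨hIinvs, hbacks, -⟩ := back_I hch hxr hWr hUs hrels
  have hIiJg : IsFrame (Pc (nb (nb x t₂) (-(Jstep Pc nb ⟨x, t₁, t₂, U⟩).t₁)))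
      (IinvStep Pc nb (Jstep Pc nb ⟨x, t₁, t₂, U⟩)).t₁ (IinvStep Pc nb (Jstep Pc nb ⟨x, t₁, t₂, U⟩)).t₂
      (IinvStep Pc nb (Jstep Pc nb ⟨x, t₁, t₂, U⟩)).U := by
    have ex : nb x t₂ = xs := congrArg ZFrame.pt hs
    rw [hs, ex, hIinvs]
    show IsFrame (Pc (nb xs (-as))) ar br Wr
    rw [hbacks]; exact hWr
  rw [hq] at hIIg hJIg hIiIg hJiIg hIg hcomm
  rw [hs] at hJJg hIJg hJiJg hIiJg hJg hcomm
  have ex : nb x t₁ = xq := congrArg ZFrame.pt hq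
  have es : nb x t₂ = xs := congrArg ZFrame.pt hs
  rw [ex] at hIiIg hJiIg ⊢
  rw [es] at hJiJg hIiJg ⊢
  exact ⟨hx, hU, hIg, hJg, hIig, hJig, hIIg, hJIg, hIiIg, hJiIg, hJJg, hIJg, hJiJg, hIiJg, hcomm⟩

/-- **The layer above a coherent layer is coherent** (`V`-images), and the letter read below
the new layer is the parity of the old one. [folklore] -/
theorem layer_up (hch : ∀ z ∈ S, IsZChart S z (ac z) (Pc z) (Ac z) (nb z)) {Φ : ℤ → ℤ → ZFrame}
    (hval : ∀ i j, IsFrame (Pc (Φ i j).pt) (Φ i j).t₁ (Φ i j).t₂ (Φ i j).U)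
    (hS : ∀ i j, (Φ i j).pt ∈ S) (hI : ∀ i j, Φ (i + 1) j = Istep Pc nb (Φ i j))
    (hJ : ∀ i j, Φ i (j + 1) = Jstep Pc nb (Φ i j)) :
    (∀ i j, IsFrame (Pc (Vstep Pc nb (Φ i j)).pt) (Vstep Pc nb (Φ i j)).t₁ (Vstep Pc nb (Φ i j)).t₂
      (Vstep Pc nb (Φ i j)).U) ∧
    (∀ i j, (Vstep Pc nb (Φ i j)).pt ∈ S) ∧
    (∀ i j, Vstep Pc nb (Φ (i + 1) j) = Istep Pc nb (Vstep Pc nb (Φ i j))) ∧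
    (∀ i j, Vstep Pc nb (Φ i (j + 1)) = Jstep Pc nb (Vstep Pc nb (Φ i j))) ∧
    (∀ i j, lowerParity (Vstep Pc nb (Φ i j)).t₁ (Vstep Pc nb (Φ i j)).t₂
        (lowerCap (Pc (Vstep Pc nb (Φ i j)).pt) (Vstep Pc nb (Φ i j)).t₁ (Vstep Pc nb (Φ i j)).t₂
          (Vstep Pc nb (Φ i j)).U) = frameParity (Φ i j).t₁ (Φ i j).t₂ (Φ i j).U) := by
  refine ⟨fun i j => ?_, fun i j => ?_, fun i j => ?_, fun i j => ?_, fun i j => ?_⟩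
  all_goals
    rcases h : Φ i j with ⟨x, t₁, t₂, U⟩
    obtain ⟨hx, hU, hIg, hJg, hIig, hJig, hIIg, hJIg, hIiIg, hJiIg, hJJg, hIJg, hJiJg, hIiJg, hcomm⟩ :=
      nbhd hch hval hS hI hJ i j h
  · exact (Vstep_spec hch hx hU hIg hJg hIig hJig).2.2.2.2.2.1
  · exact (Vstep_spec hch hx hU hIg hJg hIig hJig).2.1
  · rw [hI, h]; exact Vstep_Istep_comm hch hx hU hIg hJg hIig hJig hIIg hJIg hIiIg hJiIg hcomm
  · rw [hJ, h]; exact Vstep_Jstep_comm hch hx hU hIg hJg hIig hJig hJJg hIJg hJiJg hIiJg hcomm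
  · exact (Vstep_spec hch hx hU hIg hJg hIig hJig).2.2.2.2.2.2.1

/-- **The layer below a coherent layer is coherent** (`V⁻¹`-images), and the parity of the new
layer is the letter read below the old one. [folklore] -/
theorem layer_down (hch : ∀ z ∈ S, IsZChart S z (ac z) (Pc z) (Ac z) (nb z)) {Φ : ℤ → ℤ → ZFrame}
    (hval : ∀ i j, IsFrame (Pc (Φ i j).pt) (Φ i j).t₁ (Φ i j).t₂ (Φ i j).U)
    (hS : ∀ i j, (Φ i j).pt ∈ S) (hI : ∀ i j, Φ (i + 1) j = Istep Pc nb (Φ i j))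
    (hJ : ∀ i j, Φ i (j + 1) = Jstep Pc nb (Φ i j)) :
    (∀ i j, IsFrame (Pc (VinvStep Pc nb (Φ i j)).pt) (VinvStep Pc nb (Φ i j)).t₁
      (VinvStep Pc nb (Φ i j)).t₂ (VinvStep Pc nb (Φ i j)).U) ∧
    (∀ i j, (VinvStep Pc nb (Φ i j)).pt ∈ S) ∧
    (∀ i j, VinvStep Pc nb (Φ (i + 1) j) = Istep Pc nb (VinvStep Pc nb (Φ i j))) ∧
    (∀ i j, VinvStep Pc nb (Φ i (j + 1)) = Jstep Pc nb (VinvStep Pc nb (Φ i j))) ∧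
    (∀ i j, frameParity (VinvStep Pc nb (Φ i j)).t₁ (VinvStep Pc nb (Φ i j)).t₂ (VinvStep Pc nb (Φ i j)).U =
      lowerParity (Φ i j).t₁ (Φ i j).t₂ (lowerCap (Pc (Φ i j).pt) (Φ i j).t₁ (Φ i j).t₂ (Φ i j).U)) := by
  refine ⟨fun i j => ?_, fun i j => ?_, fun i j => ?_, fun i j => ?_, fun i j => ?_⟩
  all_goals
    rcases h : Φ i j with ⟨x, t₁, t₂, U⟩
    obtain ⟨hx, hU, hIg, hJg, hIig, hJig, hIIg, hJIg, hIiIg, hJiIg, hJJg, hIJg, hJiJg, hIiJg, hcomm⟩ :=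
      nbhd hch hval hS hI hJ i j h
  · exact (VinvStep_spec hch hx hU hIg hJg hIig hJig).2.2.2.2.2.1
  · exact (VinvStep_spec hch hx hU hIg hJg hIig hJig).2.1
  · rw [hI, h]; exact VinvStep_Istep_comm hch hx hU hIg hJg hIig hJig hIIg hJIg hIiIg hJiIg hcomm
  · rw [hJ, h]; exact VinvStep_Jstep_comm hch hx hU hIg hJg hIig hJig hJJg hIJg hJiJg hIiJg hcomm
  · exact (VinvStep_spec hch hx hU hIg hJg hIig hJig).2.2.2.2.2.2.1

end Summit.AtomisticToContinuum.Crystallization.Theorems.PalmUnimodularRigidityShellsToBarlowChart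

end
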